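import Summits.CriticalPhenomena.PercolationContinuityZ3.Theorems.PercNonProliferationFreeBoxPowerSavingBoundaryInteriorSplit
import Summits.CriticalPhenomena.PercolationContinuityZ3.Theorems.FreeBoxPowerSaving.Negative.FreeBoxPowerSavingQuasiGiant

/-!
# Crux `PercNonProliferation.FreeBoxPowerSaving` (stmt-CriticalPhenomena-4447), line
# `boundary-interior-split-fat-finite-clusters` — confined quasi-giants: the first-moment reduction

Supports (does not close) the crux `PercNonProliferation.FreeBoxPowerSaving`.  The line's interior
stub `stub_confinedQuasiGiantsVanish` ((I₁): for some `a > 0`,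
`P_{p_c}(IQG_n(n^{3-a})) → 0`, where `IQG_n(s)` = "some in-box piece of `Λ_n = box 3 n` AVOIDING
the inner vertex boundary `∂ⁱⁿΛ_n` has `≥ s` vertices") is OPEN: every known route needs an upper
bound WITH A RATE on finite critical clusters of `ℤ³` (search log
`stub_confinedQuasiGiantsVanish.md` next to this file in the lead's folder).  This file
kernel-checks the translation-averaging reduction through which such a rate would enter
(registered sub-goal `confinedQuasiGiant_firstMoment`), at EVERY parameter `p`:

* `confinedQuasiGiant_firstMoment` — for all `p`, `n`, `s > 0`:
  `s · P_p(IQG_n(s)) ≤ |Λ_n| · P_p(s ≤ #{y ∈ Λ_{2n} : 0 ↔ y} ∧ C(0) ⊆ Λ_{2n})`.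
  A piece avoiding `∂ⁱⁿΛ_n` is a whole (finite) cluster confined to `Λ_n`
  (`BoundaryInteriorSplit.mem_piece_of_reachable`), so each of its `≥ s` vertices `v` sees, after
  recentring at `v` (`BoundaryInteriorSplit.centred_piece`), at least `s` vertices of `Λ_{2n}`
  joined to `0` and `C(0) ⊆ Λ_{2n}`; Markov for the resulting sum of indicators
  (`BoundaryInteriorSplit.mul_measureReal_le_sum`) and translation invariance
  (`bondPercolation_real_preimage_shift`) conclude.
* `confinedQuasiGiantsVanish_of_centredRate` — consequently the stub (I₁) VERBATIM follows from any
  centred rate `n^a · P_{p_c}(n^{3-a} ≤ #{y ∈ Λ_{2n} : 0 ↔ y} ∧ C(0) ⊆ Λ_{2n}) → 0` (`a > 0`),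
  since `|Λ_n| ≤ 27 n³`.  Contrapositive ("angle (A)" of the search log): if (I₁) fails at
  exponent `a`, then `P_{p_c}(n^{3-a} ≤ |C(0)| < ∞) ≥ P_{p_c}(centred event) ≥ η n^{-a} / 27`
  along a subsequence — a finite-cluster volume tail `≥ c s^{-a/(3-a)}` at `s = n^{3-a}`, which no
  theorem in the tree or in the located literature contradicts for `ℤ³`.
-/

noncomputable section

open MeasureTheory Filter Topology
open Literature.Probability.Percolation Literature.Probability.LatticeModels
open scoped Classical BigOperators

namespace Summit.CriticalPhenomena.PercolationContinuityZ3.FreeBoxPowerSavingLine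

namespace ConfinedQuasiGiants

open BoundaryInteriorSplit

/-- **The centred target event is measurable**: `{s ≤ #{y ∈ Λ_{2n} : 0 ↔ y}}` is a super-level
set of a finite sum of indicators of connection events, and `{C(0) ⊆ Λ_{2n}}` is measurable
(`BoundaryInteriorSplit.measurableSet_cluster_subset`). [folklore] -/
theorem measurableSet_centredFat (n : ℕ) (s : ℝ) :
    MeasurableSet {ω : BondConfig (Site 3) |
      s ≤ (((box 3 (2 * n)).filter fun y => ω ∈ openConn (0 : Site 3) y).card : ℝ) ∧
        openCluster ω 0 ⊆ ↑(box 3 (2 * n))} := by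
  have hmeas : Measurable fun ω : BondConfig (Site 3) =>
      (((box 3 (2 * n)).filter fun y => ω ∈ openConn (0 : Site 3) y).card : ℝ) := by
    have h : (fun ω : BondConfig (Site 3) =>
        (((box 3 (2 * n)).filter fun y => ω ∈ openConn (0 : Site 3) y).card : ℝ)) =
        fun ω => ∑ y ∈ box 3 (2 * n), (openConn (0 : Site 3) y).indicator
          (1 : BondConfig (Site 3) → ℝ) ω := by
      funext ω
      rw [Finset.natCast_card_filter]
      refine Finset.sum_congr rfl fun y _ => ?_
      by_cases hy : ω ∈ openConn (0 : Site 3) y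
      · rw [if_pos hy, Set.indicator_of_mem hy, Pi.one_apply]
      · rw [if_neg hy, Set.indicator_of_notMem hy]
    rw [h]
    exact Finset.measurable_sum _ fun y _ =>
      measurable_one.indicator (measurableSet_openConn_holds 0 y)
  exact (measurableSet_le measurable_const hmeas).inter (measurableSet_cluster_subset 0 _)

/-- **The pointwise count.**  If `ω ⊆ E(ℤ³)` and some piece of `Λ_n` avoiding `∂ⁱⁿΛ_n` has `≥ s`
vertices, then at least `s` of the recentred events
`A_v = (ω ↦ ω - v)⁻¹ {s ≤ #{y ∈ Λ_{2n} : 0 ↔ y} ∧ C(0) ⊆ Λ_{2n}}`, `v ∈ Λ_n`, occur — namely for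
every vertex `v` of that piece, which is a whole cluster confined to `Λ_n ⊆ v + Λ_{2n}`
(`BoundaryInteriorSplit.centred_piece`). [folklore] -/
theorem le_sum_indicator_confined (n : ℕ) (s : ℝ) {ω : BondConfig (Site 3)}
    (hω : ω ⊆ (zdGraph 3).edgeSet)
    (hIQG : ∃ u ∈ box 3 n,
      (∀ w ∈ innerBoundary (zdGraph 3) (box 3 n), ω ∉ openConnIn ↑(box 3 n) u w) ∧
      s ≤ (((box 3 n).filter fun v => ω ∈ openConnIn ↑(box 3 n) u v).card : ℝ)) :
    s ≤ ∑ v ∈ box 3 n, (BondConfig.relabel (sym2Equiv (Site.shift (-v))) ⁻¹'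
        {ω' : BondConfig (Site 3) |
          s ≤ (((box 3 (2 * n)).filter fun y => ω' ∈ openConn (0 : Site 3) y).card : ℝ) ∧
            openCluster ω' 0 ⊆ ↑(box 3 (2 * n))}).indicator (1 : BondConfig (Site 3) → ℝ) ω := by
  set A : Site 3 → Set (BondConfig (Site 3)) := fun v =>
    BondConfig.relabel (sym2Equiv (Site.shift (-v))) ⁻¹'
      {ω' : BondConfig (Site 3) |
        s ≤ (((box 3 (2 * n)).filter fun y => ω' ∈ openConn (0 : Site 3) y).card : ℝ) ∧
          openCluster ω' 0 ⊆ ↑(box 3 (2 * n))} with hA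
  obtain ⟨u, hu, havoid, hsu⟩ := hIQG
  set P := (box 3 n).filter fun v => ω ∈ openConnIn (↑(box 3 n) : Set (Site 3)) u v with hP
  -- the large piece is interior: none of its vertices lies on `∂ⁱⁿΛ_n`
  have hint : ∀ w ∈ P, w ∉ innerBoundary (zdGraph 3) (box 3 n) :=
    fun w hw hw' => havoid w hw' (Finset.mem_filter.1 hw).2
  -- every vertex of the large piece realises its recentred event
  have hmem : ∀ v ∈ P, ω ∈ A v := by
    intro v hv
    obtain ⟨hcard, hC⟩ := centred_piece n hω hu hint hv
    exact ⟨hsu.trans (by exact_mod_cast hcard), hC⟩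
  show s ≤ ∑ v ∈ box 3 n, (A v).indicator (1 : BondConfig (Site 3) → ℝ) ω
  calc s ≤ (P.card : ℝ) := hsu
    _ = ∑ v ∈ P, (A v).indicator (1 : BondConfig (Site 3) → ℝ) ω := by
        rw [Finset.sum_congr rfl fun v hv =>
          Set.indicator_of_mem (hmem v hv) (1 : BondConfig (Site 3) → ℝ)]
        simp
    _ ≤ ∑ v ∈ box 3 n, (A v).indicator (1 : BondConfig (Site 3) → ℝ) ω :=
        Finset.sum_le_sum_of_subset_of_nonneg (Finset.filter_subset _ _) fun _ _ _ =>
          Set.indicator_nonneg (fun _ _ => zero_le_one) _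

end ConfinedQuasiGiants

open ConfinedQuasiGiants BoundaryInteriorSplit

/-- **confinedQuasiGiant_firstMoment (translation averaging for confined quasi-giants; every `p`).**
For all `p`, `n` and real `s > 0`:
`s · P_p(some piece of Λ_n avoiding ∂ⁱⁿΛ_n has ≥ s vertices)
   ≤ |Λ_n| · P_p(s ≤ #{y ∈ Λ_{2n} : 0 ↔ y} ∧ C(0) ⊆ Λ_{2n})`.
Proof: the pointwise count `ConfinedQuasiGiants.le_sum_indicator_confined` (valid on the
full-measure event `ω ⊆ E(ℤ³)`, `ae_subset_edgeSet`), Markov for a sum of indicators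
(`BoundaryInteriorSplit.mul_measureReal_le_sum`) and translation invariance
(`bondPercolation_real_preimage_shift`). [folklore] -/
theorem confinedQuasiGiant_firstMoment :
    ∀ (p : unitInterval) (n : ℕ) (s : ℝ), 0 < s →
      s * (bondPercolation (zdGraph 3) p).real
          {ω | ∃ u ∈ box 3 n,
            (∀ w ∈ innerBoundary (zdGraph 3) (box 3 n), ω ∉ openConnIn ↑(box 3 n) u w) ∧
            s ≤ (((box 3 n).filter fun v => ω ∈ openConnIn ↑(box 3 n) u v).card : ℝ)}
        ≤ ((box 3 n).card : ℝ) * (bondPercolation (zdGraph 3) p).real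
          {ω | s ≤ (((box 3 (2 * n)).filter fun y => ω ∈ openConn 0 y).card : ℝ) ∧
            openCluster ω 0 ⊆ ↑(box 3 (2 * n))} := by
  intro p n s hs
  set T : Set (BondConfig (Site 3)) :=
    {ω | s ≤ (((box 3 (2 * n)).filter fun y => ω ∈ openConn 0 y).card : ℝ) ∧
      openCluster ω 0 ⊆ ↑(box 3 (2 * n))} with hT
  have hTm : MeasurableSet T := measurableSet_centredFat n s
  have h2 := mul_measureReal_le_sum (bondPercolation (zdGraph 3) p) (box 3 n)
    (fun v => BondConfig.relabel (sym2Equiv (Site.shift (-v))) ⁻¹' T)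
    (fun v _ => hTm.preimage (BondConfig.relabel _).measurable)
    {ω | ∃ u ∈ box 3 n,
      (∀ w ∈ innerBoundary (zdGraph 3) (box 3 n), ω ∉ openConnIn ↑(box 3 n) u w) ∧
      s ≤ (((box 3 n).filter fun v => ω ∈ openConnIn ↑(box 3 n) u v).card : ℝ)}
    hs.le (by
      filter_upwards [ae_subset_edgeSet (zdGraph 3) p] with ω hω hq
      exact le_sum_indicator_confined n s hω hq)
  have h3 : ∑ v ∈ box 3 n, (bondPercolation (zdGraph 3) p).real
      (BondConfig.relabel (sym2Equiv (Site.shift (-v))) ⁻¹' T) =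
      ((box 3 n).card : ℝ) * (bondPercolation (zdGraph 3) p).real T := by
    rw [Finset.sum_congr rfl fun v _ => bondPercolation_real_preimage_shift (-v) p T,
      Finset.sum_const, nsmul_eq_mul]
  exact h2.trans_eq h3

/-- **The interior stub (I₁) from a centred rate.**  If for some `a > 0`
`n^a · P_{p_c}(n^{3-a} ≤ #{y ∈ Λ_{2n} : 0 ↔ y} ∧ C(0) ⊆ Λ_{2n}) → 0`, then
`P_{p_c}(IQG_n(n^{3-a})) → 0`, i.e. the registered stub `stub_confinedQuasiGiantsVanish` holds
with the same `a`: by `confinedQuasiGiant_firstMoment` and `|Λ_n| = (2n+1)³ ≤ 27 n³` (`n ≥ 1`),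
`P_{p_c}(IQG_n(n^{3-a})) ≤ 27 n^a · P_{p_c}(centred event)`. [folklore] -/
theorem confinedQuasiGiantsVanish_of_centredRate :
    (∃ a : ℝ, 0 < a ∧ Tendsto (fun n : ℕ => (n : ℝ) ^ a *
      (bondPercolation (zdGraph 3) (criticalProbI 3)).real
        {ω | (n : ℝ) ^ (3 - a) ≤
            (((box 3 (2 * n)).filter fun y => ω ∈ openConn 0 y).card : ℝ) ∧
          openCluster ω 0 ⊆ ↑(box 3 (2 * n))}) atTop (𝓝 0)) →
    ∃ a : ℝ, 0 < a ∧ Tendsto (fun n : ℕ =>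
      (bondPercolation (zdGraph 3) (criticalProbI 3)).real
          {ω | ∃ u ∈ box 3 n,
            (∀ w ∈ innerBoundary (zdGraph 3) (box 3 n), ω ∉ openConnIn ↑(box 3 n) u w) ∧
            (n : ℝ) ^ (3 - a) ≤
              (((box 3 n).filter fun v => ω ∈ openConnIn ↑(box 3 n) u v).card : ℝ)}) atTop (𝓝 0) := by
  rintro ⟨a, ha, hlim⟩
  refine ⟨a, ha, ?_⟩
  set μ := bondPercolation (zdGraph 3) (criticalProbI 3) with hμ
  set T : ℕ → Set (BondConfig (Site 3)) := fun n =>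
    {ω | (n : ℝ) ^ (3 - a) ≤
        (((box 3 (2 * n)).filter fun y => ω ∈ openConn 0 y).card : ℝ) ∧
      openCluster ω 0 ⊆ ↑(box 3 (2 * n))} with hT
  have hlim27 : Tendsto (fun n : ℕ => 27 * ((n : ℝ) ^ a * μ.real (T n))) atTop (𝓝 0) := by
    simpa using hlim.const_mul (27 : ℝ)
  refine tendsto_of_tendsto_of_tendsto_of_le_of_le' tendsto_const_nhds hlim27
    (Eventually.of_forall fun n => measureReal_nonneg) ?_
  filter_upwards [eventually_ge_atTop 1] with n hn1
  have hN1 : (1 : ℝ) ≤ n := by exact_mod_cast hn1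
  have hN0 : (0 : ℝ) < n := by linarith
  have hs : 0 < (n : ℝ) ^ (3 - a) := Real.rpow_pos_of_pos hN0 _
  have hfm := confinedQuasiGiant_firstMoment (criticalProbI 3) n _ hs
  -- `|Λ_n| ≤ 27 n³ = 27 n^a · n^{3-a}`
  have hcard : ((box 3 n).card : ℝ) ≤ 27 * ((n : ℝ) ^ a * (n : ℝ) ^ (3 - a)) := by
    rw [← Real.rpow_add hN0, show a + (3 - a) = ((3 : ℕ) : ℝ) by push_cast; ring,
      Real.rpow_natCast, FreeBoxPowerSavingNegative.card_box_real]
    have h3 : 2 * (n : ℝ) + 1 ≤ 3 * n := by linarith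
    calc (2 * (n : ℝ) + 1) ^ 3 ≤ (3 * n) ^ 3 := by gcongr
      _ = 27 * (n : ℝ) ^ 3 := by ring
  have hkey : (n : ℝ) ^ (3 - a) * μ.real {ω | ∃ u ∈ box 3 n,
      (∀ w ∈ innerBoundary (zdGraph 3) (box 3 n), ω ∉ openConnIn ↑(box 3 n) u w) ∧
      (n : ℝ) ^ (3 - a) ≤ (((box 3 n).filter fun v => ω ∈ openConnIn ↑(box 3 n) u v).card : ℝ)}
      ≤ (n : ℝ) ^ (3 - a) * (27 * ((n : ℝ) ^ a * μ.real (T n))) :=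
    calc _ ≤ ((box 3 n).card : ℝ) * μ.real (T n) := hfm
      _ ≤ 27 * ((n : ℝ) ^ a * (n : ℝ) ^ (3 - a)) * μ.real (T n) :=
          mul_le_mul_of_nonneg_right hcard measureReal_nonneg
      _ = (n : ℝ) ^ (3 - a) * (27 * ((n : ℝ) ^ a * μ.real (T n))) := by ring
  exact le_of_mul_le_mul_left hkey hs

end Summit.CriticalPhenomena.PercolationContinuityZ3.FreeBoxPowerSavingLine

end
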